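import Mathlib.Tactic.LinearCombination
import Literature.Computability.AlgebraicComplexity.STPPWreathTPP
import Literature.Computability.AlgebraicComplexity.SimultaneousDoubleProduct
import HarnessLib

/-!
# CKSU 2005, Thm. 4.3: SDPP pairs give the TPP in the wreath product `Sym(Δₙ) ⋉ (H³)^{Δₙ}`

Topic `Literature/Computability/AlgebraicComplexity`. Source: H. Cohn, R. Kleinberg, B. Szegedy,
C. Umans, *Group-theoretic algorithms for matrix multiplication*, FOCS 2005, §4 (arXiv:math/0511460,
held text `paper:arxiv-math_0511460`, chunk p0007 L118–155; FOCS Thm. 4.3 = arXiv Thm. 22), read this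
session:

"Recall that `Δₙ = {(a,b,c) ∈ ℤ³ : a+b+c = n−1 and a,b,c ≥ 0}`. Given `n` pairs of subsets `Aᵢ, Bᵢ`
in `H` for `0 ≤ i ≤ n−1`, we define triples of subsets in `H³` indexed by `v = (v₁,v₂,v₃) ∈ Δₙ` as
follows: `Â_v = A_{v₁} × {1} × B_{v₃}`, `B̂_v = B_{v₁} × A_{v₂} × {1}`, `Ĉ_v = {1} × B_{v₂} × A_{v₃}`.
**Theorem 4.3.** If `n` pairs of subsets `Aᵢ, Bᵢ ⊆ H` (with `0 ≤ i ≤ n−1`) satisfy the simultaneous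
double product property, then the following subsets `S₁, S₂, S₃` of `G = (H³)^{Δₙ} ⋊ Sym(Δₙ)` satisfy
the triple product property: `S₁ = {âπ : π ∈ Sym(Δₙ), â_v ∈ Â_v for all v}`,
`S₂ = {b̂π : … b̂_v ∈ B̂_v …}`, `S₃ = {ĉπ : … ĉ_v ∈ Ĉ_v …}`. The proof uses Theorem 7.1 and is similar
to the proof of Proposition 3.3; it can be found in the full version of this paper."

The full version never appeared; **the proof below is ours** (same skeleton as the printed proofs of
Prop. 3.3 and Thm. 7.1, `StrongUSPWreathTPP.lean` / `STPPWreathTPP.lean`): with `P, Q, R` the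
`Sym`-parts of the three quotients, `PQR = 1`, and row `v` of the `(H³)^{Δₙ}`-part reads, in the three
coordinates of `H³`, as three instances of the simultaneity clause (X) of the SDPP, giving
`(τv)₁ = v₁`, `(σv)₂ = v₂`, `(τv)₃ = (σv)₃` for the permutations `σ = P⁻¹`, `τ = (PQ)⁻¹` of `Δₙ`.
A second-moment computation on `Δₙ` (`perm_eq_one_of_coords`: with `d_v = (σv)₃ − v₃` one gets
`Σ d = Σ v₁d = Σ v₂d = 0` from the invariance of `Σ f(σv)`, `Σ f(τv)`, and `Σ ((σv)₃² − v₃²) = 0`,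
whence `Σ d² = −2Σ v₃ d = 2Σ (v₁ + v₂ − (n−1)) d = 0`) forces `σ = τ = 1`; then the double product
property (W) of each pair gives `â = â'`, `b̂ = b̂'`, `ĉ = ĉ'`.

## Formalisation (abelian `H`, additive, the setting of the tree's `IsSDPP`)

* `Tri n` — `Δₙ` as `{v : Fin 3 → Fin n // v₀ + v₁ + v₂ = n − 1}`; `hatA`, `hatB`, `hatC` — the triples
  `Â_v, B̂_v, Ĉ_v ⊆ H × H × H`; the group is the tree's `SymWreath (H × H × H) N`, `N = |Δₙ|`, rows
  indexed through `Fintype.equivFin (Tri n)`; `sdppWreathSet₁/₂/₃` — `S₁, S₂, S₃`.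
* `CohnKleinbergSzegedyUmans2005_thm22` — **Theorem 4.3 / 22**: `IsSDPP A B` ⇒ `S₁, S₂, S₃` satisfy
  the TPP (`Q(S)`-form), `realizesTPP_of_isSDPP`. Theorems only; 0 named facts.
-/

noncomputable section

namespace Literature.Computability.AlgebraicComplexity

open Finset SymWreath

namespace SDPPWreath

/-- **`Δₙ`** `= {(a,b,c) : a + b + c = n − 1}`, coordinates in `Fin n`.
[cite: CohnKleinbergSzegedyUmans2005, Thm. 4.3 (arXiv Thm. 22)] -/
def Tri (n : ℕ) : Type := {v : Fin 3 → Fin n // (v 0 : ℕ) + v 1 + v 2 = n - 1}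

/-- `Δₙ` is finite. [folklore] -/
instance (n : ℕ) : Fintype (Tri n) := by unfold Tri; infer_instance

/-- Decidable equality on `Δₙ`. [folklore] -/
instance (n : ℕ) : DecidableEq (Tri n) := by unfold Tri; infer_instance

variable {H : Type*} [AddCommGroup H] [DecidableEq H] {n : ℕ}

/-- `Â_v = A_{v₁} × {0} × B_{v₃}`. [cite: CohnKleinbergSzegedyUmans2005, Thm. 4.3 (arXiv Thm. 22)] -/
def hatA (A B : Fin n → Finset H) (v : Tri n) : Finset (H × H × H) :=
  A (v.1 0) ×ˢ (({0} : Finset H) ×ˢ B (v.1 2))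

/-- `B̂_v = B_{v₁} × A_{v₂} × {0}`. [cite: CohnKleinbergSzegedyUmans2005, Thm. 4.3 (arXiv Thm. 22)] -/
def hatB (A B : Fin n → Finset H) (v : Tri n) : Finset (H × H × H) :=
  B (v.1 0) ×ˢ (A (v.1 1) ×ˢ ({0} : Finset H))

/-- `Ĉ_v = {0} × B_{v₂} × A_{v₃}`. [cite: CohnKleinbergSzegedyUmans2005, Thm. 4.3 (arXiv Thm. 22)] -/
def hatC (A B : Fin n → Finset H) (v : Tri n) : Finset (H × H × H) :=
  ({0} : Finset H) ×ˢ (B (v.1 1) ×ˢ A (v.1 2))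

/-- Rows of the wreath product are indexed by `Fin |Δₙ|` through this enumeration. [folklore] -/
def triEquiv (n : ℕ) : Tri n ≃ Fin (Fintype.card (Tri n)) := Fintype.equivFin (Tri n)

/-- `S₁ = {âπ : â_v ∈ Â_v}`. [cite: CohnKleinbergSzegedyUmans2005, Thm. 4.3 (arXiv Thm. 22)] -/
def sdppWreathSet₁ (A B : Fin n → Finset H) : Finset (SymWreath (H × H × H) (Fintype.card (Tri n))) :=
  stppSet fun r => hatA A B ((triEquiv n).symm r)

/-- `S₂ = {b̂π : b̂_v ∈ B̂_v}`. [cite: CohnKleinbergSzegedyUmans2005, Thm. 4.3 (arXiv Thm. 22)] -/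
def sdppWreathSet₂ (A B : Fin n → Finset H) : Finset (SymWreath (H × H × H) (Fintype.card (Tri n))) :=
  stppSet fun r => hatB A B ((triEquiv n).symm r)

/-- `S₃ = {ĉπ : ĉ_v ∈ Ĉ_v}`. [cite: CohnKleinbergSzegedyUmans2005, Thm. 4.3 (arXiv Thm. 22)] -/
def sdppWreathSet₃ (A B : Fin n → Finset H) : Finset (SymWreath (H × H × H) (Fintype.card (Tri n))) :=
  stppSet fun r => hatC A B ((triEquiv n).symm r)

/-! ### The combinatorial core on `Δₙ` -/

/-- **Second-moment lemma on `Δₙ`.** Let `σ, τ` be permutations of an index set carrying three integer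
coordinates `F₀, F₁, F₂` with `F₀ + F₁ + F₂` constant, such that `F₀ ∘ τ = F₀`, `F₁ ∘ σ = F₁` and
`F₂ ∘ τ = F₂ ∘ σ`. Then `F₂ ∘ σ = F₂` (hence `σ` and `τ` fix all three coordinates). Proof: with
`d = F₂∘σ − F₂`, `Σ d = Σ F₁ d = Σ F₀ d = 0` and `Σ (F₂∘σ)² = Σ F₂²`, so `Σ d² = 0`. (Ours; the
paper's proof of Thm. 4.3 is in its unpublished full version.) [cite: CohnKleinbergSzegedyUmans2005, Thm. 4.3 (arXiv Thm. 22)] -/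
theorem comp_eq_of_coords {ι : Type*} [Fintype ι] (σ τ : Equiv.Perm ι) (F₀ F₁ F₂ : ι → ℤ) (c : ℤ)
    (hsum : ∀ r, F₀ r + F₁ r + F₂ r = c) (h₀ : ∀ r, F₀ (τ r) = F₀ r) (h₁ : ∀ r, F₁ (σ r) = F₁ r)
    (h₂ : ∀ r, F₂ (τ r) = F₂ (σ r)) : ∀ r, F₂ (σ r) = F₂ r := by
  -- the four invariant sums
  have S1 : ∑ r, F₂ (σ r) = ∑ r, F₂ r := Equiv.sum_comp σ F₂
  have S2 : ∑ r, F₁ r * F₂ (σ r) = ∑ r, F₁ r * F₂ r := by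
    calc ∑ r, F₁ r * F₂ (σ r) = ∑ r, F₁ (σ r) * F₂ (σ r) := by simp_rw [h₁]
      _ = ∑ r, F₁ r * F₂ r := Equiv.sum_comp σ (fun r => F₁ r * F₂ r)
  have S3 : ∑ r, F₀ r * F₂ (σ r) = ∑ r, F₀ r * F₂ r := by
    calc ∑ r, F₀ r * F₂ (σ r) = ∑ r, F₀ (τ r) * F₂ (τ r) := by simp_rw [h₀, h₂]
      _ = ∑ r, F₀ r * F₂ r := Equiv.sum_comp τ (fun r => F₀ r * F₂ r)
  have S4 : ∑ r, F₂ (σ r) * F₂ (σ r) = ∑ r, F₂ r * F₂ r := Equiv.sum_comp σ (fun r => F₂ r * F₂ r)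
  -- `Σ F₂ (F₂∘σ)` computed through `F₂ = c − F₀ − F₁`
  have E1 : ∑ r, F₂ r * F₂ (σ r) = ∑ r, (c - F₀ r - F₁ r) * F₂ (σ r) :=
    Finset.sum_congr rfl fun r _ => by rw [← hsum r]; ring
  have E2 : ∑ r, F₂ r * F₂ r = ∑ r, (c - F₀ r - F₁ r) * F₂ r :=
    Finset.sum_congr rfl fun r _ => by rw [← hsum r]; ring
  have E1' : ∑ r, (c - F₀ r - F₁ r) * F₂ (σ r) =
      c * ∑ r, F₂ (σ r) - ∑ r, F₀ r * F₂ (σ r) - ∑ r, F₁ r * F₂ (σ r) := by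
    rw [Finset.mul_sum, ← Finset.sum_sub_distrib, ← Finset.sum_sub_distrib]
    exact Finset.sum_congr rfl fun r _ => by ring
  have E2' : ∑ r, (c - F₀ r - F₁ r) * F₂ r =
      c * ∑ r, F₂ r - ∑ r, F₀ r * F₂ r - ∑ r, F₁ r * F₂ r := by
    rw [Finset.mul_sum, ← Finset.sum_sub_distrib, ← Finset.sum_sub_distrib]
    exact Finset.sum_congr rfl fun r _ => by ring
  -- `Σ d² = 0`
  have hsq : ∑ r, (F₂ (σ r) - F₂ r) ^ 2 =
      ∑ r, F₂ (σ r) * F₂ (σ r) - 2 * ∑ r, F₂ r * F₂ (σ r) + ∑ r, F₂ r * F₂ r := by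
    rw [Finset.mul_sum, ← Finset.sum_sub_distrib, ← Finset.sum_add_distrib]
    exact Finset.sum_congr rfl fun r _ => by ring
  have hzero : ∑ r, (F₂ (σ r) - F₂ r) ^ 2 = 0 := by
    rw [hsq]
    linear_combination S4 - 2 * E1 - 2 * E1' + 2 * E2 + 2 * E2' - 2 * c * S1 + 2 * S3 + 2 * S2
  have hall := (Finset.sum_eq_zero_iff_of_nonneg fun r _ => sq_nonneg (F₂ (σ r) - F₂ r)).mp hzero
  intro r
  have := hall r (Finset.mem_univ r)
  exact sub_eq_zero.mp (pow_eq_zero_iff two_ne_zero |>.mp this)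

/-! ### Theorem 4.3 / 22 -/

/-- `(a a'⁻¹)ᵢ = aᵢ − a'_{P⁻¹ i}`. [folklore] -/
private theorem mul_inv_left_apply'' {K : Type*} [AddCommGroup K] {m : ℕ} (a a' : SymWreath K m)
    (j : Fin m) : (a * a'⁻¹).left j = a.left j - a'.left ((a * a'⁻¹).right⁻¹ j) := by
  simp [sub_eq_add_neg, mul_inv_rev]

/-- `(XYZ)ᵢ = Xᵢ + Y_{P⁻¹ i} + Z_{Q⁻¹ P⁻¹ i}`. [folklore] -/
private theorem mul_mul_left_apply'' {K : Type*} [AddCommGroup K] {m : ℕ} (X Y Z : SymWreath K m)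
    (i : Fin m) :
    (X * Y * Z).left i = X.left i + Y.left (X.right⁻¹ i) + Z.left (Y.right⁻¹ (X.right⁻¹ i)) := by
  simp [mul_inv_rev]

/-- **Cohn–Kleinberg–Szegedy–Umans 2005, Theorem 4.3 (arXiv Thm. 22)**, abelian `H`: if the pairs
`(Aᵢ, Bᵢ)_{i<n}` satisfy the simultaneous double product property (the tree's `IsSDPP`), then
`S₁, S₂, S₃ ⊆ Sym(Δₙ) ⋉ (H³)^{Δₙ}` satisfy the triple product property (`Q(S)`-form). The printed
text defers the proof to the unpublished full version; the proof here is ours (see the module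
docstring). [cite: CohnKleinbergSzegedyUmans2005, Thm. 4.3 (arXiv Thm. 22)] -/
theorem CohnKleinbergSzegedyUmans2005_thm22 {A B : Fin n → Finset H} (hS : IsSDPP A B) :
    ∀ s ∈ sdppWreathSet₁ A B, ∀ s' ∈ sdppWreathSet₁ A B, ∀ t ∈ sdppWreathSet₂ A B,
      ∀ t' ∈ sdppWreathSet₂ A B, ∀ u ∈ sdppWreathSet₃ A B, ∀ u' ∈ sdppWreathSet₃ A B,
      s * s'⁻¹ * (t * t'⁻¹) * (u * u'⁻¹) = 1 → s = s' ∧ t = t' ∧ u = u' := by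
  intro s hs s' hs' t ht t' ht' u hu u' hu' h
  simp only [sdppWreathSet₁, sdppWreathSet₂, sdppWreathSet₃, mem_stppSet, hatA, hatB, hatC,
    Finset.mem_product, Finset.mem_singleton] at hs hs' ht ht' hu hu'
  set e := (triEquiv n).symm with he
  have hPQR : (s * s'⁻¹).right * (t * t'⁻¹).right * (u * u'⁻¹).right = 1 :=
    congrArg SymWreath.right h
  set P := (s * s'⁻¹).right with hP
  set Q := (t * t'⁻¹).right with hQ
  set R := (u * u'⁻¹).right with hR
  have hRQP : ∀ i, R⁻¹ (Q⁻¹ (P⁻¹ i)) = i := fun i => by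
    have e1 : (P * Q * R)⁻¹ = 1 := by rw [hPQR, inv_one]
    have := congrArg (fun g : Equiv.Perm (Fin (Fintype.card (Tri n))) => g i) e1
    simpa [mul_inv_rev] using this
  -- the row equations in `H × H × H`
  have hL : ∀ i, (s.left i - s'.left (P⁻¹ i)) + (t.left (P⁻¹ i) - t'.left (Q⁻¹ (P⁻¹ i))) +
      (u.left (Q⁻¹ (P⁻¹ i)) - u'.left i) = 0 := by
    intro i
    have hL0 : (s * s'⁻¹ * (t * t'⁻¹) * (u * u'⁻¹)).left i = 0 := by rw [h]; rfl
    rw [mul_mul_left_apply'', mul_inv_left_apply'' s s', mul_inv_left_apply'' t t',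
      mul_inv_left_apply'' u u'] at hL0
    rw [← hP, ← hQ, ← hR, hRQP i] at hL0
    exact hL0
  -- coordinates: `(τ i)₀ = i₀`, `(σ i)₁ = i₁`, `(τ i)₂ = (σ i)₂` for `σ = P⁻¹`, `τ = Q⁻¹P⁻¹`
  have hc0 : ∀ i, (e (Q⁻¹ (P⁻¹ i))).1 0 = (e i).1 0 := by
    intro i
    have h1 := congrArg Prod.fst (hL i)
    simp only [Prod.fst_add, Prod.fst_sub, Prod.fst_zero, (hu _).1, (hu' _).1, sub_zero,
      add_zero] at h1
    -- `(a − a') + (β − β') = 0`, `a ∈ A i₀`, `a' ∈ A b₀`, `β ∈ B b₀`, `β' ∈ B c₀`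
    exact (hS.simultaneous (hs i).1 (hs' _).1 (ht _).1 (ht' _).1 h1).symm
  have hc1 : ∀ i, (e (P⁻¹ i)).1 1 = (e i).1 1 := by
    intro i
    have h1 := congrArg (fun x : H × H × H => x.2.1) (hL i)
    simp only [Prod.snd_add, Prod.snd_sub, Prod.fst_add, Prod.fst_sub, Prod.snd_zero, Prod.fst_zero,
      (hs i).2.1, (hs' _).2.1, sub_zero, zero_add] at h1
    -- `(α − α') + (γ − γ') = 0`, `α ∈ A b₁`, `α' ∈ A c₁`, `γ ∈ B c₁`, `γ' ∈ B i₁`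
    exact hS.simultaneous (ht _).2.1 (ht' _).2.1 (hu _).2.1 (hu' _).2.1 h1
  have hc2 : ∀ i, (e (Q⁻¹ (P⁻¹ i))).1 2 = (e (P⁻¹ i)).1 2 := by
    intro i
    have h1 := congrArg (fun x : H × H × H => x.2.2) (hL i)
    simp only [Prod.snd_add, Prod.snd_sub, Prod.snd_zero, (ht _).2.2, (ht' _).2.2, sub_zero,
      add_zero] at h1
    -- `(β₃ − β₃') + (δ − δ') = 0`, `β₃ ∈ B i₂`, `β₃' ∈ B b₂`, `δ ∈ A c₂`, `δ' ∈ A i₂`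
    exact hS.simultaneous (hu _).2.2 (hu' _).2.2 (hs i).2.2 (hs' _).2.2 (by rw [← h1]; abel)
  -- the second-moment lemma
  have key := comp_eq_of_coords P⁻¹ (Q⁻¹ * P⁻¹) (fun i => (((e i).1 0 : ℕ) : ℤ))
    (fun i => (((e i).1 1 : ℕ) : ℤ)) (fun i => (((e i).1 2 : ℕ) : ℤ)) ((n : ℤ) - 1)
    (fun i => by
      have := (e i).2
      have h3 : (((e i).1 0 : ℕ) : ℤ) + ((e i).1 1 : ℕ) + ((e i).1 2 : ℕ) = ((n - 1 : ℕ) : ℤ) := by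
        exact_mod_cast this
      rw [h3, Nat.cast_sub (by have := ((e i).1 0).isLt; omega), Nat.cast_one])
    (fun i => by simp only [Equiv.Perm.mul_apply, hc0 i])
    (fun i => by simp only [hc1 i])
    (fun i => by simp only [Equiv.Perm.mul_apply, hc2 i])
  -- `P = 1` and `Q = 1`
  have hσ : ∀ i, P⁻¹ i = i := by
    intro i
    have h2 : (e (P⁻¹ i)).1 2 = (e i).1 2 := Fin.ext (by exact_mod_cast key i)
    have h1 := hc1 i
    have h0 : ((e (P⁻¹ i)).1 0 : ℕ) = (e i).1 0 := by
      have a := (e (P⁻¹ i)).2; have b := (e i).2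
      rw [h1, h2] at a; omega
    apply e.injective
    apply Subtype.ext
    funext j
    fin_cases j
    · exact Fin.ext h0
    · exact h1
    · exact h2
  have hP1 : P = 1 := inv_eq_one.mp (Equiv.ext fun i => by simpa using hσ i)
  have hτ : ∀ i, Q⁻¹ i = i := by
    intro i
    have h0 := hc0 i; have h2 := hc2 i
    rw [hσ i] at h0 h2
    have h1 : ((e (Q⁻¹ i)).1 1 : ℕ) = (e i).1 1 := by
      have a := (e (Q⁻¹ i)).2; have b := (e i).2
      rw [h0, h2] at a; omega
    apply e.injective
    apply Subtype.ext
    funext j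
    fin_cases j
    · exact h0
    · exact Fin.ext h1
    · exact h2
  have hQ1 : Q = 1 := inv_eq_one.mp (Equiv.ext fun i => by simpa using hτ i)
  have hR1 : R = 1 := by rwa [hP1, hQ1, one_mul, one_mul] at hPQR
  -- the double product property of each pair, coordinatewise
  have hrows : ∀ i, s.left i = s'.left i ∧ t.left i = t'.left i ∧ u.left i = u'.left i := by
    intro i
    have hi := hL i
    simp only [hP1, hQ1, inv_one, Equiv.Perm.one_apply] at hi
    have f1 := congrArg Prod.fst hi
    have f2 := congrArg (fun x : H × H × H => x.2.1) hi
    have f3 := congrArg (fun x : H × H × H => x.2.2) hi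
    simp only [Prod.fst_add, Prod.fst_sub, Prod.fst_zero, Prod.snd_add, Prod.snd_sub, Prod.snd_zero,
      (hu i).1, (hu' i).1, (hs i).2.1, (hs' i).2.1, (ht i).2.2, (ht' i).2.2, sub_zero, add_zero,
      zero_add] at f1 f2 f3
    -- coordinate 1: `(a − a') + (β − β') = 0` in pair `i₀`
    obtain ⟨e1a, e1b⟩ := hS.dpp ((e i).1 0) (hs i).1 (hs' i).1 (ht i).1 (ht' i).1 f1
    -- coordinate 2: `(α − α') + (γ − γ') = 0` in pair `i₁`
    obtain ⟨e2a, e2b⟩ := hS.dpp ((e i).1 1) (ht i).2.1 (ht' i).2.1 (hu i).2.1 (hu' i).2.1 f2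
    -- coordinate 3: `(δ − δ') + (β₃ − β₃') = 0` in pair `i₂`
    obtain ⟨e3a, e3b⟩ := hS.dpp ((e i).1 2) (hu i).2.2 (hu' i).2.2 (hs i).2.2 (hs' i).2.2
      (by rw [← f3]; abel)
    refine ⟨Prod.ext e1a (Prod.ext (by rw [(hs i).2.1, (hs' i).2.1]) e3b),
      Prod.ext e1b (Prod.ext e2a (by rw [(ht i).2.2, (ht' i).2.2])),
      Prod.ext (by rw [(hu i).1, (hu' i).1]) (Prod.ext e2b e3a)⟩
  have q1 : s.right * s'.right⁻¹ = 1 := by rw [hP] at hP1; exact hP1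
  have q2 : t.right * t'.right⁻¹ = 1 := by rw [hQ] at hQ1; exact hQ1
  have q3 : u.right * u'.right⁻¹ = 1 := by rw [hR] at hR1; exact hR1
  exact ⟨SymWreath.ext (funext fun i => (hrows i).1) (mul_inv_eq_one.mp q1),
    SymWreath.ext (funext fun i => (hrows i).2.1) (mul_inv_eq_one.mp q2),
    SymWreath.ext (funext fun i => (hrows i).2.2) (mul_inv_eq_one.mp q3)⟩

/-- **`Sym(Δₙ) ⋉ (H³)^{Δₙ}` realizes `⟨|S₁|, |S₂|, |S₃|⟩` for every SDPP family** (Thm. 4.3 / 22 in the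
tree's `RealizesTPP`). [cite: CohnKleinbergSzegedyUmans2005, Thm. 4.3 (arXiv Thm. 22)] -/
theorem realizesTPP_of_isSDPP {A B : Fin n → Finset H} (hS : IsSDPP A B) :
    RealizesTPP (SymWreath (H × H × H) (Fintype.card (Tri n))) (sdppWreathSet₁ A B).card
      (sdppWreathSet₂ A B).card (sdppWreathSet₃ A B).card :=
  ⟨_, _, _, rfl, rfl, rfl, CohnKleinbergSzegedyUmans2005_thm22 hS⟩

end SDPPWreath

end Literature.Computability.AlgebraicComplexity

end
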